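import Literature.MathematicalPhysics.QuantumFieldTheory.Balaban1983to89.B11Eq98CurrentSlot
import Literature.MathematicalPhysics.QuantumFieldTheory.Balaban1983to89.B11Prop6Model

/-!
# `Balaban1983to89.B11Prop6Concrete` — T. Bałaban, *The variational problem and background fields in renormalization group
# method for lattice gauge theories*, Commun. Math. Phys. **102** (1985) 277–309 [Balaban1985Variational], **Proposition 6**
# (pp. 295–296) READ AS NE3's R1^ϱ, ON THE CONCRETE (115) CARRIERS: the Sect. E slice of the [B11] leaf's carrier family
# `famLG : I → B11.LGData` AT OBJECTS — the space (115) `max{|A₁|₍₋₁₎, |∇_{U₀}A₁|₍₋₂₎}` of bond functions on the periodic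
# lattice with ITS BACKGROUND-DEPENDENT NORM (`B11Eq115Space.Space115 L η lev₀ lev₁ (nabla115 η U₀)`), the current `J` of
# (27)/(28) CONCRETE (`B11Eq98CurrentSlot.Jcur U₀`, (28) DERIVED from the bondwise display (14)), the in-edge letters
# `𝔊(U₀)` ([5] Thm 3.13), `H₁(U₀)` ([5] Thm 3.12), `B(V, U₀)` ((20) ⇐ [6] (1.37)) and B11's own Proposition-4 slot `W(U₀) = (δ/δA′)V`
# displayed ONCE with exactly their printed bounds; `B11.Prop6Printed B₀ B₃ C₁ famLG` INHABITED for every family of such data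

statement-level skeleton of published theorems with citation tags; proofs where landed; nothing here is a claim
about the Yang–Mills mass gap

PDF held: `paper:balaban1985-cmp102-variational-background` (journal page = PDF page + 276); pp. 280–282 (PDF 4–6), 293–296
(PDF 17–20) read from the held text by this seat (2026-08-26).

WHAT IS REPRODUCED.  SKELETON row `B11.Prop6` (reader r08 `ROWS-B11.md`; decl of record `B11.Prop6Printed`, B11.lean :272).  THE
PRINT (p. 295 [PDF 19] – p. 296 [PDF 20], verbatim): *«Proposition 6. There exists a positive, absolute constant a₄ such, that for
ε₄ ≤ a₄ and ε₁ satisfying 2B₀C₁B₃ε₁ ≤ ε₄ Eq. (111) has exactly one solution in the space (115). This solution satisfies the bounds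
(115) with ε₄ = 3B₀C₁B₃ε₁. Moreover, if we replace the configuration H₁B by an arbitrary configuration 𝔄 with values in the
complexified Lie algebra, and satisfying the same bounds as H₁B, then the above statement is again true and the solution is an analytic
function of 𝔄.»*  With (111) p. 294 *«A₁ + 𝔊J + 𝔊((δ/δA′)V)(A₁ + H₁B) = 0»*, (115) p. 294 *«max{|A₁|₍₋₁₎, |∇A₁|₍₋₂₎} < ε₄»*,
(116)–(117) p. 295 *«A solution of Eq. (111) is a fixed point of the transformation A₁ → −𝔊J − 𝔊((δ/δA′)V)(A₁ + H₁B). (116) … By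
Theorem 3.13 of [5] the norm max{|·|₍₋₁₎, |∇·|₍₋₂₎} of the transformation can be estimated by B₀|J|₍₋₃₎ + B₀|((δ/δA′)V)(A₁ +
H₁B)|₍₋₃₎ < B₀C₁B₃ε₁ + B₀C₄(ε₄ + B₀|B|)², (117) if ε₄ + B₀|B| ≤ a₃. Further, we have the bound |B| < 2dLC₁ε₁»*, (14) p. 280
*«U₀ ∈ 𝔘_k({Ω_j}, C₁B₃ε₁), |Ū₀ʲ − V| < C₁ε₁ on Λ_j, j = 0, 1, …, k»* with (2) p. 278 *«|(D*_U∂U)(b)| < ε₀L^{−2j}(Lʲη)⁻¹ =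
ε₀η²(Lʲη)⁻³ for b ∈ Ω_j»*, (28) p. 282 *«J = D*η⁻² Im ∂U₀ = Im η⁻²D*∂U₀, |J| < C₁B₃ε₁(Lʲη)⁻³ on Ω_j, (28) the bound holds by the
assumption (14)»*, (20) p. 281 *«Q_j(U₀, ηA) = B on Λ_j, j = 0, 1, …, k, (20) where B is given by the formulas (1.31) in [6], hence
|B| < 2dLC₁ε₁»*, (103) p. 293 *«|H₁B| < B₀2dLC₁ε₁(Lʲη)⁻¹, |∇H₁B| < B₀2dLC₁ε₁(Lʲη)⁻² on Ω_j»*, Prop. 4 (98) p. 293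
*«|((δ/δA′)V)(A′)|₍₋₃₎ ≤ C₄(max{|A′|₍₋₁₎, |∇A′|₍₋₂₎})², (98) … valid if max{…} ≤ a₃»*, and (121) p. 295 *«contractive if 2ε₄ +
4dLB₀C₁ε₁ ≤ a₃, 4B₀C₄(ε₄ + 2dLB₀C₁ε₁) ≤ ½. (121)»*.  [5] = [Balaban1985BackgroundPropagators], [6] = [Balaban1985RegularSpaces].

WHY THIS FILE (cell context; pub-ymgap D-0062 Track A, node N07 = [B11], seat dag-n07-b g2; ROSTER-D0062 row n07 «-b: Prop 6 p.295 (= NE3's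
R1^ϱ verbatim — share with n16)»).  Every printed step of Sect. E is kernel-checked: over ABSTRACT complex Banach spaces in `B11Prop6Scheme`
(`bound_117`, `mapsTo_118`, `lipschitz_120`, `existsUnique_solution`, `prop6_solution`, `solution_analytic`), packaged as the solution operator
`B11Eq174Chart.solA`/`Regime`, read as NE3's residual-separated response R1^ϱ in `T4FixedPointResponse` §3 (`norm_solution_le_two(_exact)`), and
connected to the typed statement of record by `B11Prop6Model.prop6Printed_model` — for the MODEL family `SchemeDatum.toLGData`, whose carriers are
abstract Banach spaces with ONE space `𝒴 i` per index and whose (14) is READ AS «‖J U₀‖ ≤ a».  At OBJECTS the (115) norm is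
`max{|A₁|₍₋₁₎, |∇A₁|₍₋₂₎}` with `∇ = ∇^{U₀}` the covariant derivative OF THE BACKGROUND ([5] (3.3); `B11Eq111FrakG.nabla115`), so the space
(115) is a normed space INDEXED BY `U₀` (`B11Eq115Space.Space115 L η lev₀ lev₁ (nabla115 η U₀)`, the NE9 lineage's carrier, on which the letters
`𝔊` (`B11Eq111FrakG.frakGAt`), `H₁` (`B11Eq103H1Complex.H1LatticeCLM`), `W = (δ/δA′)V` (`B11Eq80Current.W80`, Prop. 4 at letters
`B11Eq98CurrentSlot.prop4Hyp_W80`) and `J` (`B11Eq98CurrentSlot.Jcur`, (28) PROVED `norm_Jcur_le`) are typed) — the model family can meet these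
objects only by moving `U₀` into the index.  THIS FILE types the Sect. E slice of the leaf carrier `B11.LGData` AT THESE OBJECTS: one type of
fields `Fld := Bond d Pd → 𝔸` whose size `nMax U₀ A := ‖A‖_{(115),U₀}` depends on the background as printed, Eq. (111) literally with the CONCRETE
current `Jcur U₀`, and the inputs of the printed proof that belong to OTHER nodes displayed ONCE as background-indexed letters with exactly their
printed bounds — `𝔊(U₀)` with ‖𝔊(U₀)f‖₍₁₁₅₎ ≤ B₀‖f‖₍₋₃₎ (*«By Theorem 3.13 of [5]»*, DAG in-edge N06), `H₁(U₀)` with ‖H₁(U₀)b‖₍₁₁₅₎ ≤ B₀‖b‖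
([5] Thm 3.12 as used in (103), in-edge N06), the constraint configuration `B(V, U₀)` of (20) whose bound |B| < 2dL·b is the reading of (14)'s
second clause (*«hence |B| < 2dLC₁ε₁»* ⇐ [6] (1.37), in-edge N05; proved on B11's carriers in `B11Eq20BoundB`), and `W(U₀)` with Proposition 4
(`B11Prop6Scheme.Prop4Hyp`, the leaf's OWN conjunct p4, inhabited at letters by `prop4Hyp_W80`) — every OTHER field of `B11.LGData` (Sects. A–C,
Prop. 5's (112)) a PARAMETER (`Rest`), so that a pin of the leaf carrier (pub-ymgap NODE 00 Stage 3′(Z), dag-n07-a's `B11-PIN-SOCKET.md` §3 «famLG …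
at objects — today only MODEL families») EXTENDS this datum instead of meeting inert fields.  ONE proof serves both rows the ROSTER pairs: N07's leaf
conjunct `p6` (§4) and NE3's R1^ϱ at the objects (§2, `r1rho_concrete(_exact)`), cited by name.

WHAT IS DEFINED AND PROVED (sorry-free; axioms standard; no `Prop`-valued definition asserted; no inequality of the series is NEW here).
§1 `InU2cur L η lev₀ a U₀` — the CURRENT clause of the class (2)/(14) read bondwise with the level weights (the hypothesis `h14` of
   `B11Eq98CurrentSlot.norm_Jcur_le`, named); `IsUnitaryBg U₀` (`U₀(b)⁻¹ = U₀(b)*`, its hypothesis `hU`).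
§2 PIN-INDEPENDENT THEOREMS on `Space115 L η lev₀ lev₁ (nabla115 η U₀)` at ONE background, letters as hypotheses with their printed bounds:
   **`exists_solution_concrete`** (Prop. 6 (i)/(ii): for `U₀` unitary in the (2)-class of radius `C₁B₃ε₁`, a datum `𝔄` with ‖𝔄‖ < 2dLB₀C₁ε₁,
   `2B₀C₁B₃ε₁ ≤ ε₄ ≤ a₄ = min{a₃/4, (16B₀C₄)⁻¹}` (unfolded), `dL ≤ B₃`: EXACTLY ONE `A₁` in the open ball (115) solves
   `A₁ + 𝔊(Jcur U₀) + 𝔊(W(A₁ + 𝔄)) = 0`, and ‖A₁‖ < 3B₀C₁B₃ε₁ — (28) DERIVED, not read);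
   **`exists_solution_concrete_H₁B`** (the same at `𝔄 := H₁(U₀)B` from ‖H₁(U₀)‖ ≤ B₀ and |B| < 2dLC₁ε₁: (103) DERIVED);
   **`r1rho_concrete`** (R1^ϱ AT THE OBJECTS: every solution in the ball obeys ‖A₁‖₍₁₁₅₎ ≤ 2‖𝔊(U₀)J(U₀)‖₍₁₁₅₎ + 2B₀C₄‖𝔄‖², Γ = 2 from (121)),
   `r1rho_concrete_printed` (the same under Prop. 6's own regime, `a = 2dLB₀C₁ε₁`), **`r1rho_concrete_exact`** (`𝔄 = 0`: ‖A₁‖ ≤ 2‖𝔊J‖ — NE3's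
   instance p. 299 «B = 0»), `solA_spec_concrete` (the tree's selector `B11Eq174Chart.solA` IS that solution), **`solution_analytic_concrete`**
   (Prop. 6 (iii): holomorphic dependence on `𝔄` along holomorphic families, `Regime.solA_differentiableOn`).
§3 `SectEDatum` (per lattice: backgrounds `Cfg` read on the bonds by `bg`, their admissible part `Adm`, boundary data `Bdry`, the letters `G W H₁ Bcfg`
   with `norm_G`, `prop4`, `norm_H₁` AT ADMISSIBLE backgrounds, `dL_le`), `Rest` (the other fields of `B11.LGData` + the pin's own `Sat14` with its
   printed CONSEQUENCES `sat14_cur`, `sat14_B` and the admissibility reading `sat14_adm` of p. 280), `toSp`/`ofSp` (a bond function read in (115)_{U₀}),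
   `H₁B`, **`SectEDatum.toLGData`**, unfolding lemmas `sat14_cur_of`, `sat14_B_of`, `adm_of`, `sol111_iff`, `norm_H₁B_lt`.
§4 **`prop6Printed_concrete : B11.Prop6Printed B₀ B₃ C₁ (fun i ↦ (D i).toLGData (R i) C₁)`** for EVERY family of Sect. E data over lattices
   `Pd i`, spacings `η i` (fixed d, L, 𝔸, printed constants, threshold α; ONE a₄ = min{a₃/4, (16B₀C₄)⁻¹, 2B₀α} before the index), `exists_solution_carrier`, and the dictionary **`prop4Printed_concrete`** (on this family
   the typed Proposition 4 is the slot `prop4`, BY HYPOTHESIS — as in the model).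

HONEST SCOPE.  (i) A JUNCTION / object-level knit of ONE leaf conjunct modulo the in-edge letters and the p4 slot: nothing of [5] Thms 3.12/3.13, of
[6] (1.37) or of Prop. 4 is proved here (they are the displayed fields `norm_G`, `norm_H₁`, `sat14_B`, `prop4`); (28) and (103) ARE derived.  (ii) The
letters' bounds are asked at the ADMISSIBLE backgrounds `Adm` only, and (14) at radius ≤ α is read as admissibility (`Rest.sat14_adm`; print p. 280
*«We assume that the numbers a₀, a₁ are so small that all the theorems of the papers [4, 6] are valid for the configurations U, U₀»*, and [5] (3.35) for
U₀ *«because of the result of Sect. F»*) — whence the third member 2B₀α of a₄.  (iii) `a₄` =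
min{a₃/4, (16B₀C₄)⁻¹, 2B₀α} (§4; §2 displays the first two members unfolded) is (d, L)-dependent through a₃, C₄, B₀, α (DIVERGENCE D-B11-3
«absolute»).  (iv) Uniformity of B₀, C₄, a₃ in the lattice is the
in-edges' content, displayed not adjudicated; the per-lattice OBJECT charts with background-dependent radii are the NE9 lineage's
`NE9CurChartOneInstance.cur_chart_exists_oneInstance*` (Summits side), untouched.  (v) Count-neutral for pub-ymgap Track A (N07 NOT discharged; the
pin `Z11OfRecord` is NODE 00's).  Mega-formalization context `lit-balaban` row B11.Prop6; cell pub-ymgap seat dag-n07-b g2 (`--supports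
stmt-QuantumFields-19183`).  Imports `B11Eq98CurrentSlot` (→ `B11Eq80Current` → … → `B11Eq115Space`, `T4FixedPointResponse`) and `B11Prop6Model`
(→ `B11Eq174Chart` → `B11Prop6Scheme`) ONLY; modifies nothing.  Net new unproved facts: 0.
-/

noncomputable section

open Metric Set

namespace Literature.MathematicalPhysics.QuantumFieldTheory.Balaban1983to89.B11Prop6Concrete

open B13Contraction113 (QuadAnalytic)
open B11Prop6Scheme (mapT mapT_noLinear Prop4Hyp le_a4_iff)
open B11Eq174Chart (solA Regime)
open B11Prop6Model (eq111_iff_fixed exists_solution_open)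
open B11Eq98CurrentSlot (Jcur norm_Jcur_le)
open B11Eq90V0primeCurrent (Tsh Ucur)
open B11Eq111FrakG (nabla115)
open B9SectCLatticeCarrier (Bond)
open B11Eq115Space

variable {𝔸 : Type} [NormedRing 𝔸] [NormedAlgebra ℂ 𝔸]
variable {d : ℕ} {Pd : Fin d → ℕ} {L η : ℝ} [Fact (0 < L)] [Fact (0 < η)]
  {lev₀ : Bond d Pd → ℕ} {lev₁ : Bond d Pd × Fin d → ℕ}

/-! ## §1 The class (2)/(14) at objects: the current clause read bondwise, and unitarity of the background -/

/-- **The CURRENT clause of `U₀ ∈ 𝔘_k({Ω_j}, a)`** ((2) p. 278: *«|(D*_U∂U)(b)| < ε₀L^{−2j}(Lʲη)⁻¹ = ε₀η²(Lʲη)⁻³ for b ∈ Ω_j»*, at ε₀ = a; (14)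
p. 280 has a = C₁B₃ε₁) read BONDWISE on the periodic lattice with the level weights `(L^{j(b)}η)` of `B11Eq115Space.levWeight` (the domain
sequence {Ω_j} enters only through the level map `lev₀`): exactly the hypothesis `h14` of `B11Eq98CurrentSlot.norm_Jcur_le`, named.  (The
PLAQUETTE clause of (2) is not used by Sect. E and is left to the pin's `Sat14`.) [cite: Balaban1985Variational, (2) p.278, (14) p.280] -/
def InU2cur (L η : ℝ) (lev₀ : Bond d Pd → ℕ) (a : ℝ) (U₀ : Bond d Pd → 𝔸ˣ) : Prop :=
  ∀ b : Bond d Pd, ‖B9Eq39Adjoint.divPη Tsh (Ucur U₀) η (B11Eq27Current.plaqField Tsh (Ucur U₀)) b.2 b.1‖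
    ≤ a * η ^ 2 * (levWeight L η lev₀ 1 b)⁻¹ ^ 3

/-- **G-valued background**: `U₀(b)⁻¹ = U₀(b)*` at every bond (the gauge group G ⊂ U(N), p. 277; the hypothesis `hU` of `norm_Jcur_le`, under
which `|Im X| ≤ |X|` gives (28) from (2)). [cite: Balaban1985Variational, p.277, (28) p.282] -/
def IsUnitaryBg [StarRing 𝔸] (U₀ : Bond d Pd → 𝔸ˣ) : Prop :=
  ∀ b : Bond d Pd, (((U₀ b)⁻¹ : 𝔸ˣ) : 𝔸) = star (U₀ b : 𝔸)

/-! ## §2 Proposition 6 = R1^ϱ on the space (115) of ONE background — pin-independent theorems -/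

section OneBackground

variable (U₀ : Bond d Pd → 𝔸ˣ)
  {𝒢 : NegSize L η lev₀ 3 𝔸 →L[ℂ] Space115 L η lev₀ lev₁ (nabla115 η U₀)}
  {W : Space115 L η lev₀ lev₁ (nabla115 η U₀) → NegSize L η lev₀ 3 𝔸} {B₀ C₄ a₃ : ℝ}

/-! ### §2a R1^ϱ at the objects (no completeness, no unitarity needed: statements about a GIVEN solution) -/

/-- **R1^ϱ AT THE OBJECTS (defect form, Γ = 2).**  In the contraction regime of Sect. E with the PRINTED constant ½ of (121) (here:
`2(ε₄ + a) ≤ a₃`, `4B₀C₄(ε₄ + a) ≤ ½`, ‖𝔄‖ < a), every solution `A₁` of (111) in the ball ‖A₁‖₍₁₁₅₎ ≤ ε₄ obeys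
`‖A₁‖₍₁₁₅₎ ≤ 2‖𝔊(U₀)J(U₀)‖₍₁₁₅₎ + 2B₀C₄‖𝔄‖²` — the residual enters ONLY through the propagated concrete current `𝔊(Jcur U₀)` (NE3's ϱ = ‖𝔊J‖,
pub-balaban v4 re-cut R1^ϱ; `T4FixedPointResponse.norm_solution_le_two` read at the objects).  ONE statement for both rows the ROSTER pairs
(n07 Prop. 6 / n16 R1^ϱ). [cite: Balaban1985Variational, (116) and (121) p.295] -/
theorem r1rho_concrete (h𝒢 : ∀ f, ‖𝒢 f‖ ≤ B₀ * ‖f‖) (hW : QuadAnalytic W C₄ a₃) (hB₀ : 0 ≤ B₀) (hC₄ : 0 ≤ C₄)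
    {a ε₄ : ℝ} {𝔄 : Space115 L η lev₀ lev₁ (nabla115 η U₀)} (h𝔄 : ‖𝔄‖ < a) (hε₄ : 0 ≤ ε₄) (hdom : 2 * (ε₄ + a) ≤ a₃)
    (hhalf : 4 * B₀ * C₄ * (ε₄ + a) ≤ 1 / 2) {A₁ : Space115 L η lev₀ lev₁ (nabla115 η U₀)} (hA₁ : ‖A₁‖ ≤ ε₄)
    (hsol : A₁ + 𝒢 (Jcur U₀) + 𝒢 (W (A₁ + 𝔄)) = 0) :
    ‖A₁‖ ≤ 2 * ‖𝒢 (Jcur U₀)‖ + 2 * (B₀ * C₄ * ‖𝔄‖ ^ 2) := by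
  have hΛ : ∀ Y : Space115 L η lev₀ lev₁ (nabla115 η U₀),
      ‖(0 : Space115 L η lev₀ lev₁ (nabla115 η U₀) →L[ℂ] Space115 L η lev₀ lev₁ (nabla115 η U₀)) Y‖ ≤ 0 * ‖Y‖ :=
    fun Y => by simp
  have hfix : mapT 𝒢 0 W (Jcur U₀) 𝔄 A₁ = A₁ := (eq111_iff_fixed 𝒢 W (Jcur U₀) 𝔄 A₁).1 hsol
  have h := T4FixedPointResponse.norm_solution_le_two h𝒢 hΛ hW hB₀ hC₄ h𝔄 hε₄ hdom (by linarith) hA₁ hfix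
  simpa using h

/-- **R1^ϱ under Proposition 6's OWN regime** (`a = 2dLB₀C₁ε₁`, `2B₀C₁B₃ε₁ ≤ ε₄ ≤ a₄`, `dL ≤ B₃`; the two (121) members supplied by
`B11.ineq118_121`): `‖A₁‖₍₁₁₅₎ ≤ 2‖𝔊(U₀)J(U₀)‖₍₁₁₅₎ + 2B₀C₄‖𝔄‖²` for every solution in the ball.
[cite: Balaban1985Variational, (121) p.295, Prop. 6 p.295] -/
theorem r1rho_concrete_printed (h𝒢 : ∀ f, ‖𝒢 f‖ ≤ B₀ * ‖f‖) (hW : QuadAnalytic W C₄ a₃) (hB₀ : 0 ≤ B₀) (hC₄ : 0 ≤ C₄)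
    {C₁ B₃ ε₁ ε₄ : ℝ} (hC₁ : 0 ≤ C₁) (hε₁ : 0 ≤ ε₁) (hdLB₃ : (d : ℝ) * L ≤ B₃)
    (h1 : 2 * B₀ * C₁ * B₃ * ε₁ ≤ ε₄) (h2 : 4 * ε₄ ≤ a₃) (h3 : 16 * B₀ * C₄ * ε₄ ≤ 1)
    {𝔄 : Space115 L η lev₀ lev₁ (nabla115 η U₀)} (h𝔄 : ‖𝔄‖ < 2 * ((d : ℝ) * L) * B₀ * C₁ * ε₁)
    {A₁ : Space115 L η lev₀ lev₁ (nabla115 η U₀)} (hA₁ : ‖A₁‖ ≤ ε₄) (hsol : A₁ + 𝒢 (Jcur U₀) + 𝒢 (W (A₁ + 𝔄)) = 0) :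
    ‖A₁‖ ≤ 2 * ‖𝒢 (Jcur U₀)‖ + 2 * (B₀ * C₄ * ‖𝔄‖ ^ 2) := by
  have hdL : (0 : ℝ) ≤ (d : ℝ) * L := mul_nonneg (Nat.cast_nonneg d) (Fact.out : 0 < L).le
  have hB₃ : 0 ≤ B₃ := hdL.trans hdLB₃
  have hε₄ : 0 ≤ ε₄ := le_trans (by positivity) h1
  obtain ⟨-, h121a, h121b⟩ := B11.ineq118_121 ((d : ℝ) * L) B₀ C₁ C₄ B₃ a₃ ε₁ ε₄ hdL hB₀ hC₁ hC₄ hε₁ hε₄ hdLB₃ h1 h2 h3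
  exact r1rho_concrete U₀ h𝒢 hW hB₀ hC₄ h𝔄 hε₄ (by linarith) h121b hA₁ hsol

/-- **R1^ϱ, exact constraints** (NE3's instance, p. 299 *«Further, let us notice that B = 0»* for the background of the next step, so 𝔄 = H₁B
= 0): every solution of `A₁ + 𝔊J(U₀) + 𝔊(W(A₁)) = 0` in the ball obeys `‖A₁‖₍₁₁₅₎ ≤ 2‖𝔊(U₀)J(U₀)‖₍₁₁₅₎` — the response of the configuration
to the PROPAGATED CONCRETE RESIDUAL with constant 2. [cite: Balaban1985Variational, (116), (121) p.295, p.299] -/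
theorem r1rho_concrete_exact (h𝒢 : ∀ f, ‖𝒢 f‖ ≤ B₀ * ‖f‖) (hW : QuadAnalytic W C₄ a₃) (hB₀ : 0 ≤ B₀) (hC₄ : 0 ≤ C₄)
    {a ε₄ : ℝ} (ha : 0 < a) (hε₄ : 0 ≤ ε₄) (hdom : 2 * (ε₄ + a) ≤ a₃) (hhalf : 4 * B₀ * C₄ * (ε₄ + a) ≤ 1 / 2)
    {A₁ : Space115 L η lev₀ lev₁ (nabla115 η U₀)} (hA₁ : ‖A₁‖ ≤ ε₄) (hsol : A₁ + 𝒢 (Jcur U₀) + 𝒢 (W (A₁ + 0)) = 0) :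
    ‖A₁‖ ≤ 2 * ‖𝒢 (Jcur U₀)‖ := by
  have h𝔄 : ‖(0 : Space115 L η lev₀ lev₁ (nabla115 η U₀))‖ < a := by simpa using ha
  have h := r1rho_concrete U₀ h𝒢 hW hB₀ hC₄ h𝔄 hε₄ hdom hhalf hA₁ hsol
  simpa using h

/-- **(103) DERIVED at the objects**: with `H₁(U₀)` a letter obeying ‖H₁(U₀)b‖₍₁₁₅₎ ≤ B₀‖b‖ ([5] Thm 3.12, the operator (3.129); in-edge) and the
constraint configuration `B` of (20) with |B| < 2dLC₁ε₁ (⇐ [6] (1.37); in-edge), `‖H₁(U₀)B‖₍₁₁₅₎ < 2dLB₀C₁ε₁` — *«|H₁B| < B₀2dLC₁ε₁(Lʲη)⁻¹,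
|∇H₁B| < B₀2dLC₁ε₁(Lʲη)⁻²»* (103). [cite: Balaban1985Variational, (103) p.293, (20) p.281] -/
theorem norm_H₁B_lt_of_letters {β : Type} [Fintype β] (H₁ : (β → 𝔸) →L[ℂ] Space115 L η lev₀ lev₁ (nabla115 η U₀))
    (hH₁ : ∀ b, ‖H₁ b‖ ≤ B₀ * ‖b‖) (hB₀ : 0 < B₀) {C₁ ε₁ : ℝ} {B : β → 𝔸} (hB : ‖B‖ < 2 * ((d : ℝ) * L) * (C₁ * ε₁)) :
    ‖H₁ B‖ < 2 * ((d : ℝ) * L) * B₀ * C₁ * ε₁ :=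
  calc ‖H₁ B‖ ≤ B₀ * ‖B‖ := hH₁ B
    _ < B₀ * (2 * ((d : ℝ) * L) * (C₁ * ε₁)) := mul_lt_mul_of_pos_left hB hB₀
    _ = 2 * ((d : ℝ) * L) * B₀ * C₁ * ε₁ := by ring

/-! ### §2b Existence, uniqueness, the printed bound and analyticity (finite-dimensional fibre; unitary background in the class (2)) -/

section Existence

variable [FiniteDimensional ℂ 𝔸] [StarRing 𝔸] [NormedStarGroup 𝔸] [StarModule ℂ 𝔸]

/-- **Proposition 6 (i)/(ii) ON THE CONCRETE SPACE (115) OF THE BACKGROUND `U₀`** (`𝔄` = H₁B or Prop. 6's «arbitrary configuration 𝔄 …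
satisfying the same bounds»): for a unitary `U₀` in the current class (2) of radius `C₁B₃ε₁` ((14)), a propagator letter `𝔊` with
‖𝔊f‖₍₁₁₅₎ ≤ B₀‖f‖₍₋₃₎ (*«By Theorem 3.13 of [5]»*), a functional-derivative letter `W = (δ/δA′)V` with Proposition 4's (98) + line-analyticity,
`dL ≤ B₃`, `2B₀C₁B₃ε₁ ≤ ε₄`, `ε₄ ≤ a₄` unfolded as `4ε₄ ≤ a₃ ∧ 16B₀C₄ε₄ ≤ 1`, and ‖𝔄‖₍₁₁₅₎ < 2dLB₀C₁ε₁ ((103)): Eq. (111)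
`A₁ + 𝔊J(U₀) + 𝔊(W(A₁ + 𝔄)) = 0` with the CONCRETE current `J(U₀) = Jcur U₀` has a solution in the OPEN ball (115) of radius ε₄, of size
< 3B₀C₁B₃ε₁, and every solution in that ball equals it.  (28) is DERIVED (`norm_Jcur_le`); the rest is `B11Prop6Model.exists_solution_open`
(= `B11Prop6Scheme.prop6_solution` + strict ball). [cite: Balaban1985Variational, Prop. 6 p.295, (28) p.282] -/
theorem exists_solution_concrete (h𝒢 : ∀ f, ‖𝒢 f‖ ≤ B₀ * ‖f‖) (hW : QuadAnalytic W C₄ a₃) (hB₀ : 0 < B₀) (hC₄ : 0 < C₄)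
    {C₁ B₃ ε₁ ε₄ : ℝ} (hC₁ : 0 < C₁) (hB₃ : 0 < B₃) (hε₁ : 0 < ε₁) (hdLB₃ : (d : ℝ) * L ≤ B₃)
    (h1 : 2 * B₀ * C₁ * B₃ * ε₁ ≤ ε₄) (h2 : 4 * ε₄ ≤ a₃) (h3 : 16 * B₀ * C₄ * ε₄ ≤ 1)
    (hU : IsUnitaryBg U₀) (h14 : InU2cur L η lev₀ (C₁ * B₃ * ε₁) U₀)
    {𝔄 : Space115 L η lev₀ lev₁ (nabla115 η U₀)} (h𝔄 : ‖𝔄‖ < 2 * ((d : ℝ) * L) * B₀ * C₁ * ε₁) :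
    ∃ A₁ : Space115 L η lev₀ lev₁ (nabla115 η U₀), ‖A₁‖ < ε₄ ∧
      A₁ + 𝒢 (Jcur U₀) + 𝒢 (W (A₁ + 𝔄)) = 0 ∧ ‖A₁‖ < 3 * B₀ * C₁ * B₃ * ε₁ ∧
      ∀ A₁' : Space115 L η lev₀ lev₁ (nabla115 η U₀), ‖A₁'‖ < ε₄ →
        A₁' + 𝒢 (Jcur U₀) + 𝒢 (W (A₁' + 𝔄)) = 0 → A₁' = A₁ :=
  have hdL : (0 : ℝ) ≤ (d : ℝ) * L := mul_nonneg (Nat.cast_nonneg d) (Fact.out : 0 < L).le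
  exists_solution_open h𝒢 hW hB₀ hC₄ hdL hC₁ hB₃ hε₁ hdLB₃ h1 h2 h3
    (norm_Jcur_le U₀ hU (by positivity) h14) h𝔄

/-- **Proposition 6 (i) at `𝔄 := H₁(U₀)B`, with (103) AND (28) DERIVED**: the letters enter only through their printed bounds ([5] Thms 3.12,
3.13, [6] (1.37), Prop. 4). [cite: Balaban1985Variational, Prop. 6 p.295, (103) p.293] -/
theorem exists_solution_concrete_H₁B (h𝒢 : ∀ f, ‖𝒢 f‖ ≤ B₀ * ‖f‖) (hW : QuadAnalytic W C₄ a₃) (hB₀ : 0 < B₀) (hC₄ : 0 < C₄)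
    {C₁ B₃ ε₁ ε₄ : ℝ} (hC₁ : 0 < C₁) (hB₃ : 0 < B₃) (hε₁ : 0 < ε₁) (hdLB₃ : (d : ℝ) * L ≤ B₃)
    (h1 : 2 * B₀ * C₁ * B₃ * ε₁ ≤ ε₄) (h2 : 4 * ε₄ ≤ a₃) (h3 : 16 * B₀ * C₄ * ε₄ ≤ 1)
    (hU : IsUnitaryBg U₀) (h14 : InU2cur L η lev₀ (C₁ * B₃ * ε₁) U₀)
    {β : Type} [Fintype β] (H₁ : (β → 𝔸) →L[ℂ] Space115 L η lev₀ lev₁ (nabla115 η U₀)) (hH₁ : ∀ b, ‖H₁ b‖ ≤ B₀ * ‖b‖)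
    {B : β → 𝔸} (hB : ‖B‖ < 2 * ((d : ℝ) * L) * (C₁ * ε₁)) :
    ∃ A₁ : Space115 L η lev₀ lev₁ (nabla115 η U₀), ‖A₁‖ < ε₄ ∧
      A₁ + 𝒢 (Jcur U₀) + 𝒢 (W (A₁ + H₁ B)) = 0 ∧ ‖A₁‖ < 3 * B₀ * C₁ * B₃ * ε₁ ∧
      ∀ A₁' : Space115 L η lev₀ lev₁ (nabla115 η U₀), ‖A₁'‖ < ε₄ →
        A₁' + 𝒢 (Jcur U₀) + 𝒢 (W (A₁' + H₁ B)) = 0 → A₁' = A₁ :=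
  exists_solution_concrete U₀ h𝒢 hW hB₀ hC₄ hC₁ hB₃ hε₁ hdLB₃ h1 h2 h3 hU h14 (norm_H₁B_lt_of_letters U₀ H₁ hH₁ hB₀ hB)

/-- **The tree's solution selector IS the solution**: in Proposition 6's regime the operator `𝒜 = B11Eq174Chart.solA 𝔊 0 W J(U₀) ε₄` evaluated
at `𝔄` lies in the open ball (115), solves (111) and has size < 3B₀C₁B₃ε₁ (so every statement about «the solution» is a statement about `solA`).
[cite: Balaban1985Variational, Prop. 6 p.295] -/
theorem solA_spec_concrete (h𝒢 : ∀ f, ‖𝒢 f‖ ≤ B₀ * ‖f‖) (hW : QuadAnalytic W C₄ a₃) (hB₀ : 0 < B₀) (hC₄ : 0 < C₄)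
    {C₁ B₃ ε₁ ε₄ : ℝ} (hC₁ : 0 < C₁) (hB₃ : 0 < B₃) (hε₁ : 0 < ε₁) (hdLB₃ : (d : ℝ) * L ≤ B₃)
    (h1 : 2 * B₀ * C₁ * B₃ * ε₁ ≤ ε₄) (h2 : 4 * ε₄ ≤ a₃) (h3 : 16 * B₀ * C₄ * ε₄ ≤ 1)
    (hU : IsUnitaryBg U₀) (h14 : InU2cur L η lev₀ (C₁ * B₃ * ε₁) U₀)
    {𝔄 : Space115 L η lev₀ lev₁ (nabla115 η U₀)} (h𝔄 : ‖𝔄‖ < 2 * ((d : ℝ) * L) * B₀ * C₁ * ε₁) :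
    ‖solA 𝒢 0 W (Jcur U₀) ε₄ 𝔄‖ < ε₄ ∧
      solA 𝒢 0 W (Jcur U₀) ε₄ 𝔄 + 𝒢 (Jcur U₀) + 𝒢 (W (solA 𝒢 0 W (Jcur U₀) ε₄ 𝔄 + 𝔄)) = 0 ∧
      ‖solA 𝒢 0 W (Jcur U₀) ε₄ 𝔄‖ < 3 * B₀ * C₁ * B₃ * ε₁ := by
  have hdL : (0 : ℝ) ≤ (d : ℝ) * L := mul_nonneg (Nat.cast_nonneg d) (Fact.out : 0 < L).le
  have hε₄ : 0 ≤ ε₄ := le_trans (by positivity) h1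
  have R := Regime.ofProp6 (𝒢 := 𝒢) (W := W) h𝒢 hW hB₀.le hC₄.le hdL hC₁.le hε₁.le hε₄ hdLB₃ h1 h2 h3
  have hJ := norm_Jcur_le (L := L) (η := η) (lev₀ := lev₀) U₀ hU (by positivity) h14
  obtain ⟨A₁, hA, hsol, hA3, huniq⟩ := exists_solution_concrete U₀ h𝒢 hW hB₀ hC₄ hC₁ hB₃ hε₁ hdLB₃ h1 h2 h3 hU h14 h𝔄
  have hfix : mapT 𝒢 0 W (Jcur U₀) 𝔄 A₁ = A₁ := (eq111_iff_fixed 𝒢 W (Jcur U₀) 𝔄 A₁).1 hsol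
  have heq : A₁ = solA 𝒢 0 W (Jcur U₀) ε₄ 𝔄 := R.eq_solA hJ h𝔄 hA.le hfix
  rw [← heq]
  exact ⟨hA, hsol, hA3⟩

/-- **Proposition 6 (iii) at the objects — «the solution is an analytic function of 𝔄»** (p. 296: *«the analyticity follows from the fact
that the solution can be constructed as a uniform limit of a sequence of successive approximations»*): along every holomorphic family
`σ ↦ 𝔄_σ` with values in the region (103) of the CONCRETE space (115), `σ ↦ 𝒜(𝔄_σ)` is holomorphic (`W` with Proposition 4 in the Fréchet form
`Prop4Hyp`; `B11Eq174Chart.Regime.solA_differentiableOn`). [cite: Balaban1985Variational, Prop. 6 p.296] -/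
theorem solution_analytic_concrete (h𝒢 : ∀ f, ‖𝒢 f‖ ≤ B₀ * ‖f‖) (hW : Prop4Hyp W C₄ a₃) (hB₀ : 0 < B₀) (hC₄ : 0 < C₄)
    {C₁ B₃ ε₁ ε₄ : ℝ} (hC₁ : 0 < C₁) (hB₃ : 0 < B₃) (hε₁ : 0 < ε₁) (hdLB₃ : (d : ℝ) * L ≤ B₃)
    (h1 : 2 * B₀ * C₁ * B₃ * ε₁ ≤ ε₄) (h2 : 4 * ε₄ ≤ a₃) (h3 : 16 * B₀ * C₄ * ε₄ ≤ 1)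
    (hU : IsUnitaryBg U₀) (h14 : InU2cur L η lev₀ (C₁ * B₃ * ε₁) U₀)
    {V : Set ℂ} (hV : IsOpen V) {𝔄f : ℂ → Space115 L η lev₀ lev₁ (nabla115 η U₀)} (h𝔄d : DifferentiableOn ℂ 𝔄f V)
    (h𝔄b : ∀ σ ∈ V, ‖𝔄f σ‖ < 2 * ((d : ℝ) * L) * B₀ * C₁ * ε₁) :
    DifferentiableOn ℂ (fun σ => solA 𝒢 0 W (Jcur U₀) ε₄ (𝔄f σ)) V := by
  have hdL : (0 : ℝ) ≤ (d : ℝ) * L := mul_nonneg (Nat.cast_nonneg d) (Fact.out : 0 < L).le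
  have hε₄ : 0 ≤ ε₄ := le_trans (by positivity) h1
  have R := Regime.ofProp6 (𝒢 := 𝒢) (W := W) h𝒢 hW.quadAnalytic hB₀.le hC₄.le hdL hC₁.le hε₁.le hε₄ hdLB₃ h1 h2 h3
  have hJ := norm_Jcur_le (L := L) (η := η) (lev₀ := lev₀) U₀ hU (by positivity) h14
  exact R.solA_differentiableOn hW hV (differentiableOn_const _) h𝔄d (fun _ _ => hJ) h𝔄b

end Existence

end OneBackground

/-! ## §3 The Sect. E slice of the leaf carrier `B11.LGData` at objects -/

/-- **A Sect. E datum AT OBJECTS** over the periodic lattice with periods `Pd`, fibre algebra `𝔸 ⊇ 𝔤ᶜ`, scale letters `L`, `η` and the printed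
constants B₀ ((117)), C₄, a₃ (Prop. 4), B₃ ((162)) and an admissibility threshold `α` for the radius of (14); `β` indexes the bonds of the coarse lattices Λ_j carrying the constraint configuration `B` of
(20).  Fields: the background type `Cfg` read on the bonds by `bg` (G-valued: `bg_unitary`) with its admissible part `Adm`, the boundary-data type `Bdry`;
level maps; the BACKGROUND-INDEXED LETTERS with exactly their printed bounds AT ADMISSIBLE BACKGROUNDS — `G c = 𝔊(U₀)` : |·|₍₋₃₎ → (115)_{U₀} with `norm_G` (*«By Theorem 3.13 of [5]»*,
(117); DAG in-edge N06), `W c = ((δ/δA′)V)` at `U₀` with `prop4` (Proposition 4 (97)–(98) + analyticity, the leaf's own conjunct), `H₁ c` with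
`norm_H₁` ([5] Thm 3.12 as used in (103); in-edge N06), `Bcfg V c = B` ((20), [6] (1.31)); and `dL_le` (dL ≤ B₃, true for the B₃ of (162)).
Objects inhabiting the slots in the tree: `B11Eq111FrakG.frakGAt`, `B11Eq80Current.W80` (`B11Eq98CurrentSlot.prop4Hyp_W80`),
`B11Eq103H1Complex.H1LatticeCLM`. [cite: Balaban1985Variational, (14) p.280, (20) p.281, (103) p.293, (111) p.294, (117) p.295] -/
structure SectEDatum (d : ℕ) (Pd : Fin d → ℕ) (𝔸 : Type) [NormedRing 𝔸] [NormedAlgebra ℂ 𝔸] [StarRing 𝔸] (L η : ℝ) [Fact (0 < L)]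
    [Fact (0 < η)] (β : Type) [Fintype β] (B₀ C₄ a₃ B₃ α : ℝ) where
  /-- the backgrounds U₀ (configurations on Ω₀) -/
  Cfg : Type
  /-- the ADMISSIBLE backgrounds: those at which the in-edge letters' bounds ([5] Thms 3.12, 3.13) and Proposition 4 hold (p. 280: *«We assume
  that the numbers a₀, a₁ are so small that all the theorems of the papers [4, 6] are valid for the configurations U, U₀»*; [5] (3.35) for U₀
  *«because of the result of Sect. F»*); reached by (14) at radius ≤ α (`Rest.sat14_adm`) -/
  Adm : Cfg → Prop
  /-- the boundary data V of (3)/(7) -/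
  Bdry : Type
  /-- level map of the bonds (b ∈ Ω_{j(b)}) -/
  lev₀ : Bond d Pd → ℕ
  /-- level map of the points of ∇A -/
  lev₁ : Bond d Pd × Fin d → ℕ
  /-- a background read on the positively oriented bonds -/
  bg : Cfg → Bond d Pd → 𝔸ˣ
  /-- backgrounds are G-valued, G ⊂ U(N) -/
  bg_unitary : ∀ c, IsUnitaryBg (bg c)
  /-- 𝔊(U₀) = G₁𝔓* ((110)–(111); [5] (3.148)/(3.153)) -/
  G : ∀ c : Cfg, NegSize L η lev₀ 3 𝔸 →L[ℂ] Space115 L η lev₀ lev₁ (nabla115 η (bg c))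
  /-- W(U₀) = (δ/δA′)V, V the terms of order ≥ 3 of (81) around U₀ -/
  W : ∀ c : Cfg, Space115 L η lev₀ lev₁ (nabla115 η (bg c)) → NegSize L η lev₀ 3 𝔸
  /-- H₁(U₀), the operator (3.129) of [5] producing H₁B ((99)–(103)) -/
  H₁ : ∀ c : Cfg, (β → 𝔸) →L[ℂ] Space115 L η lev₀ lev₁ (nabla115 η (bg c))
  /-- the constraint configuration B of (20), determined by V and U₀ through (1.31) of [6] -/
  Bcfg : Bdry → Cfg → β → 𝔸
  /-- (117) «By Theorem 3.13 of [5]»: ‖𝔊(U₀)f‖₍₁₁₅₎ ≤ B₀‖f‖₍₋₃₎ at admissible U₀ — an INPUT (in-edge N06) -/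
  norm_G : ∀ c, Adm c → ∀ f, ‖G c f‖ ≤ B₀ * ‖f‖
  /-- Proposition 4 (97)–(98) and the analyticity of (δ/δA′)V at admissible U₀ — an INPUT (leaf conjunct p4) -/
  prop4 : ∀ c, Adm c → Prop4Hyp (W c) C₄ a₃
  /-- [5] Thm 3.12 as used in (103): ‖H₁(U₀)b‖₍₁₁₅₎ ≤ B₀‖b‖ at admissible U₀ — an INPUT (in-edge N06) -/
  norm_H₁ : ∀ c, Adm c → ∀ b, ‖H₁ c b‖ ≤ B₀ * ‖b‖
  /-- dL ≤ B₃ (located condition of `B11Prop6Scheme.prop6_solution`; true for the B₃ of (162)) -/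
  dL_le : (d : ℝ) * L ≤ B₃

variable [StarRing 𝔸] {β : Type} [Fintype β] {B₀ C₄ a₃ B₃ α : ℝ}

/-- **The remaining fields of `B11.LGData`** — Sects. A–C data and Prop. 5's chart (112), untouched by Proposition 6 — as PARAMETERS (so a pin of the
leaf carrier extends this datum), together with the pin's OWN hypothesis (14) `Sat14 a b V U₀` and its two printed CONSEQUENCES used by Sect. E:
`sat14_cur` (the current clause of (2) at radius a, bondwise) and `sat14_B` (*«hence |B| < 2dLC₁ε₁»* (20) at b = C₁ε₁, i.e. sup|B| < 2dL·b —
[6] (1.37), in-edge N05; proved on B11's carriers in `B11Eq20BoundB`). [cite: Balaban1985Variational, (14)–(21) pp.280–281, (112) p.294] -/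
structure Rest (D : SectEDatum d Pd 𝔸 L η β B₀ C₄ a₃ B₃ α) where
  /-- perturbations U′, U₁ -/
  Pert : Type
  /-- gauge transformations -/
  GT : Type
  /-- cells of 𝔅_k -/
  Cell : Type
  /-- sites of the Λ_j -/
  Site : Type
  /-- scale of a site -/
  scale : Site → ℕ
  /-- scale of a cell -/
  cscale : Cell → ℕ
  /-- d(c₋, y) -/
  dist : Cell → Site → ℝ
  /-- the pin's hypothesis (14) with parameters (a, b) -/
  Sat14 : ℝ → ℝ → D.Bdry → D.Cfg → Prop
  /-- (14) ⇒ U₀ lies in the current class (2) of radius a -/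
  sat14_cur : ∀ a b V c, Sat14 a b V c → InU2cur L η D.lev₀ a (D.bg c)
  /-- (14) ⇒ «|B| < 2dL·b» ((20); [6] (1.37)) -/
  sat14_B : ∀ a b V c, Sat14 a b V c → ‖D.Bcfg V c‖ < 2 * ((d : ℝ) * L) * b
  /-- (14) at radius ≤ α ⇒ U₀ is an admissible background (p. 280) -/
  sat14_adm : ∀ a b V c, Sat14 a b V c → a ≤ α → D.Adm c
  /-- (18) -/
  In18 : ℝ → D.Bdry → D.Cfg → Pert → Prop
  /-- criticality for (5) -/
  Crit : D.Bdry → D.Cfg → Pert → Prop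
  /-- (19)–(21) -/
  In19_21 : ℝ → D.Bdry → D.Cfg → Pert → Prop
  /-- criticality in the space (19)–(21) -/
  CritL : D.Bdry → D.Cfg → Pert → Prop
  /-- \overline{R₀u}ʲ = 1 -/
  Restricted : D.Cfg → GT → Prop
  /-- (16) -/
  toAxial : D.Cfg → Pert → GT → Pert
  /-- (43) -/
  In43 : D.Cfg → ℝ → (Bond d Pd → 𝔸) → Prop
  /-- |·|₍₋₁₎ -/
  nM1 : D.Cfg → (Bond d Pd → 𝔸) → ℝ
  /-- (47) defined and analytic -/
  Def47 : D.Cfg → ℝ → Prop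
  /-- (47) -/
  T47 : D.Cfg → (Bond d Pd → 𝔸) → (Bond d Pd → 𝔸)
  /-- |D(A′)| -/
  normD : D.Cfg → (Bond d Pd → 𝔸) → ℝ
  /-- sup |𝔇(A′; c, b)| -/
  kerD : D.Cfg → (Bond d Pd → 𝔸) → Cell → Site → ℝ
  /-- (112) -/
  T112 : D.Bdry → D.Cfg → (Bond d Pd → 𝔸) → Pert

namespace SectEDatum

variable (D : SectEDatum d Pd 𝔸 L η β B₀ C₄ a₃ B₃ α)

/-- A bond function READ IN THE SPACE (115) OF THE BACKGROUND `U₀ = bg c` (the identification of `B11Eq115Space.JetSup` with plain functions; the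
norm it acquires is `max{|A|₍₋₁₎, |∇_{U₀}A|₍₋₂₎}`). [cite: Balaban1985Variational, (115) p.294] -/
def toSp (c : D.Cfg) (A : Bond d Pd → 𝔸) : Space115 L η D.lev₀ D.lev₁ (nabla115 η (D.bg c)) :=
  (JetSup.equiv (levWeight L η D.lev₀ 1) (levWeight L η D.lev₁ 2) (nabla115 η (D.bg c))).symm A

/-- The plain bond function of an element of (115)_{U₀} (inverse reading of `toSp`). [cite: Balaban1985Variational, (115) p.294] -/
def ofSp (c : D.Cfg) (X : Space115 L η D.lev₀ D.lev₁ (nabla115 η (D.bg c))) : Bond d Pd → 𝔸 :=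
  JetSup.equiv (levWeight L η D.lev₀ 1) (levWeight L η D.lev₁ 2) (nabla115 η (D.bg c)) X

/-- `toSp ∘ ofSp = id`: reading a plain bond function in (115)_{U₀} and back (the space (115) IS the space of 𝔤ᶜ-valued bond functions, only normed).
[cite: Balaban1985Variational, (115) p.294] -/
@[simp] theorem toSp_ofSp (c : D.Cfg) (X : Space115 L η D.lev₀ D.lev₁ (nabla115 η (D.bg c))) : D.toSp c (D.ofSp c X) = X :=
  Equiv.symm_apply_apply _ _

/-- `ofSp ∘ toSp = id` (same identification). [cite: Balaban1985Variational, (115) p.294] -/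
@[simp] theorem ofSp_toSp (c : D.Cfg) (A : Bond d Pd → 𝔸) : D.ofSp c (D.toSp c A) = A :=
  Equiv.apply_symm_apply _ _

/-- **`H₁B` at objects**: the letter `H₁(U₀)` applied to the constraint configuration `B(V, U₀)`. [cite: Balaban1985Variational, (103) p.293] -/
def H₁B (V : D.Bdry) (c : D.Cfg) : Space115 L η D.lev₀ D.lev₁ (nabla115 η (D.bg c)) :=
  D.H₁ c (D.Bcfg V c)

/-- **THE Sect. E SLICE OF THE LEAF CARRIER AT OBJECTS.**  `Fld := Bond d Pd → 𝔸` (𝔤ᶜ ⊆ 𝔸-valued vector fields on the bonds); `nMax U₀ A :=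
‖A‖_{(115),U₀}` (BACKGROUND-DEPENDENT, as printed); `Sol111 V U₀ A₁` = Eq. (111) *«A₁ + 𝔊J + 𝔊((δ/δA′)V)(A₁ + H₁B) = 0»* LITERALLY with the concrete
current `Jcur U₀`, `Sol111G` the same with an arbitrary `𝔄`; `LikeH1B ε₁ U₀ 𝔄 := ‖𝔄‖_{(115),U₀} < 2dLB₀C₁ε₁` (*«satisfying the same bounds as
H₁B»* = (103)); `SolAnalytic U₀ ε₁ ε₄` = holomorphy of `σ ↦ solA 𝔊(U₀) 0 W(U₀) J(U₀) ε₄ (𝔄_σ)` along every holomorphic family inside (103)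
(reading (M5) of `B11Prop6Model`); `dVn U₀ A := ‖W(U₀)A‖₍₋₃₎`, `dVAnalytic U₀ ε` = Fréchet-differentiability of `W(U₀)` on {‖·‖ < ε}; `Sat14` and
every Sect. A–C / (112) field from `Rest`; `L`, `dim := d`, `eta := η` the scale letters.
[cite: Balaban1985Variational, (14) p.280, (103) p.293, (111) p.294, (115) p.294] -/
def toLGData (R : Rest D) (C₁ : ℝ) : B11.LGData where
  Cfg := D.Cfg
  Bdry := D.Bdry
  Pert := R.Pert
  GT := R.GT
  Fld := Bond d Pd → 𝔸
  Cell := R.Cell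
  Site := R.Site
  L := L
  eta := η
  dim := d
  scale := R.scale
  cscale := R.cscale
  dist := R.dist
  Sat14 := R.Sat14
  In18 := R.In18
  Crit := R.Crit
  In19_21 := R.In19_21
  CritL := R.CritL
  Restricted := R.Restricted
  toAxial := R.toAxial
  In43 := R.In43
  nM1 := R.nM1
  Def47 := R.Def47
  T47 := R.T47
  normD := R.normD
  kerD := R.kerD
  nMax := fun c A => ‖D.toSp c A‖
  dVn := fun c A => ‖D.W c (D.toSp c A)‖
  dVAnalytic := fun c ε => DifferentiableOn ℂ (D.W c) {Y | ‖Y‖ < ε}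
  Sol111 := fun V c A₁ => D.toSp c A₁ + D.G c (Jcur (D.bg c)) + D.G c (D.W c (D.toSp c A₁ + D.H₁B V c)) = 0
  T112 := R.T112
  LikeH1B := fun ε₁ c 𝔄 => ‖D.toSp c 𝔄‖ < 2 * ((d : ℝ) * L) * B₀ * C₁ * ε₁
  Sol111G := fun c 𝔄 A₁ => D.toSp c A₁ + D.G c (Jcur (D.bg c)) + D.G c (D.W c (D.toSp c A₁ + D.toSp c 𝔄)) = 0
  SolAnalytic := fun c ε₁ ε₄ => ∀ V : Set ℂ, IsOpen V →
      ∀ 𝔄f : ℂ → Space115 L η D.lev₀ D.lev₁ (nabla115 η (D.bg c)), DifferentiableOn ℂ 𝔄f V →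
      (∀ σ ∈ V, ‖𝔄f σ‖ < 2 * ((d : ℝ) * L) * B₀ * C₁ * ε₁) →
      DifferentiableOn ℂ (fun σ => solA (D.G c) 0 (D.W c) (Jcur (D.bg c)) ε₄ (𝔄f σ)) V

/-- Unfolding: the carrier's (14) at the printed parameters puts `U₀` in the current class of radius `C₁B₃ε₁`. [cite: Balaban1985Variational, (14) p.280] -/
theorem sat14_cur_of (R : Rest D) (C₁ : ℝ) {B₃' ε₁ : ℝ} {V : D.Bdry} {c : D.Cfg}
    (h : (D.toLGData R C₁).Sat14 (C₁ * B₃' * ε₁) (C₁ * ε₁) V c) : InU2cur L η D.lev₀ (C₁ * B₃' * ε₁) (D.bg c) :=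
  R.sat14_cur _ _ V c h

/-- Unfolding: the carrier's (14) at the printed parameters gives «|B| < 2dLC₁ε₁» (20). [cite: Balaban1985Variational, (20) p.281] -/
theorem sat14_B_of (R : Rest D) (C₁ : ℝ) {a ε₁ : ℝ} {V : D.Bdry} {c : D.Cfg} (h : (D.toLGData R C₁).Sat14 a (C₁ * ε₁) V c) :
    ‖D.Bcfg V c‖ < 2 * ((d : ℝ) * L) * (C₁ * ε₁) :=
  R.sat14_B _ _ V c h

/-- Unfolding: the carrier's (14) at radius `C₁B₃ε₁ ≤ α` makes the background admissible. [cite: Balaban1985Variational, (14) p.280] -/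
theorem adm_of (R : Rest D) (C₁ : ℝ) {B₃' ε₁ : ℝ} {V : D.Bdry} {c : D.Cfg}
    (h : (D.toLGData R C₁).Sat14 (C₁ * B₃' * ε₁) (C₁ * ε₁) V c) (hα : C₁ * B₃' * ε₁ ≤ α) : D.Adm c :=
  R.sat14_adm _ _ V c h hα

/-- **(103) on the carrier**: under (14) at the printed parameters, `‖H₁B‖_{(115),U₀} < 2dLB₀C₁ε₁`, i.e. `H₁B` is «like H₁B».
[cite: Balaban1985Variational, (103) p.293] -/
theorem norm_H₁B_lt (R : Rest D) (C₁ : ℝ) (hB₀ : 0 < B₀) {a ε₁ : ℝ} {V : D.Bdry} {c : D.Cfg} (hc : D.Adm c)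
    (h : (D.toLGData R C₁).Sat14 a (C₁ * ε₁) V c) : ‖D.H₁B V c‖ < 2 * ((d : ℝ) * L) * B₀ * C₁ * ε₁ :=
  norm_H₁B_lt_of_letters (D.bg c) (D.H₁ c) (D.norm_H₁ c hc) hB₀ (D.sat14_B_of R C₁ h)

/-- Unfolding: the carrier's `Sol111` is Eq. (111) in (115)_{U₀} with the concrete current. [cite: Balaban1985Variational, (111) p.294] -/
theorem sol111_iff (R : Rest D) (C₁ : ℝ) (V : D.Bdry) (c : D.Cfg) (A₁ : Bond d Pd → 𝔸) :
    (D.toLGData R C₁).Sol111 V c A₁ ↔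
      D.toSp c A₁ + D.G c (Jcur (D.bg c)) + D.G c (D.W c (D.toSp c A₁ + D.H₁B V c)) = 0 :=
  Iff.rfl

end SectEDatum

/-! ## §4 Proposition 6 for every family of Sect. E data at objects -/

section Family

variable [FiniteDimensional ℂ 𝔸] [NormedStarGroup 𝔸] [StarModule ℂ 𝔸] {I : Type} {Pdf : I → Fin d → ℕ} {ηf : I → ℝ} [∀ i, Fact (0 < ηf i)] {βf : I → Type} [∀ i, Fintype (βf i)]

/-- **The conclusion of Proposition 6 (i)/(ii) on the carrier, for one datum `𝔄` read in (115)_{U₀}** (transport of `exists_solution_concrete` along the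
identification `toSp`). [cite: Balaban1985Variational, Prop. 6 p.295] -/
theorem exists_solution_carrier (D : SectEDatum d Pd 𝔸 L η β B₀ C₄ a₃ B₃ α) (R : Rest D) (hB₀ : 0 < B₀) (hC₄ : 0 < C₄)
    {C₁ ε₁ ε₄ : ℝ} (hC₁ : 0 < C₁) (hB₃ : 0 < B₃) (hε₁ : 0 < ε₁) (h1 : 2 * B₀ * C₁ * B₃ * ε₁ ≤ ε₄) (h2 : 4 * ε₄ ≤ a₃)
    (h3 : 16 * B₀ * C₄ * ε₄ ≤ 1) {V : D.Bdry} {c : D.Cfg} (hc : D.Adm c)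
    (h14 : (D.toLGData R C₁).Sat14 (C₁ * B₃ * ε₁) (C₁ * ε₁) V c)
    {𝔄 : Space115 L η D.lev₀ D.lev₁ (nabla115 η (D.bg c))} (h𝔄 : ‖𝔄‖ < 2 * ((d : ℝ) * L) * B₀ * C₁ * ε₁) :
    ∃ A₁ : Bond d Pd → 𝔸, ‖D.toSp c A₁‖ < ε₄ ∧
      D.toSp c A₁ + D.G c (Jcur (D.bg c)) + D.G c (D.W c (D.toSp c A₁ + 𝔄)) = 0 ∧ ‖D.toSp c A₁‖ < 3 * B₀ * C₁ * B₃ * ε₁ ∧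
      ∀ A₁' : Bond d Pd → 𝔸, ‖D.toSp c A₁'‖ < ε₄ →
        D.toSp c A₁' + D.G c (Jcur (D.bg c)) + D.G c (D.W c (D.toSp c A₁' + 𝔄)) = 0 → A₁' = A₁ := by
  obtain ⟨X, hX, hsol, hX3, huniq⟩ := exists_solution_concrete (D.bg c) (D.norm_G c hc) (D.prop4 c hc).quadAnalytic hB₀ hC₄ hC₁ hB₃
    hε₁ D.dL_le h1 h2 h3 (D.bg_unitary c) (D.sat14_cur_of R C₁ h14) h𝔄
  refine ⟨D.ofSp c X, ?_, ?_, ?_, fun A₁' hA₁' hsol' => ?_⟩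
  · simpa only [SectEDatum.toSp_ofSp] using hX
  · simpa only [SectEDatum.toSp_ofSp] using hsol
  · simpa only [SectEDatum.toSp_ofSp] using hX3
  · have h := huniq (D.toSp c A₁') hA₁' hsol'
    rw [← D.ofSp_toSp c A₁', h]

/-- **PROPOSITION 6 (pp. 295–296) — the typed statement of record `B11.Prop6Printed B₀ B₃ C₁ famLG` INHABITED for the Sect. E slice of the leaf
carrier AT OBJECTS**, for every family of data `D i` (lattices `Pdf i`, spacings `ηf i`, constraint-bond indices `βf i`; d, L, 𝔸 and the printed
constants and the admissibility threshold α fixed) and remaining fields `R i`: with ONE `a₄ := min{a₃/4, (16B₀C₄)⁻¹, 2B₀α}` chosen before the index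
(the third member makes the backgrounds of (14) admissible, as p. 280 assumes), for `ε₄ ≤ a₄`, `2B₀C₁B₃ε₁ ≤ ε₄` and every
`(V, U₀)` in the pin's (14) — (i) Eq. (111) with the CONCRETE current `J(U₀)` and the datum `H₁(U₀)B(V,U₀)` has exactly one solution in the space
(115)_{U₀}, of size < 3B₀C₁B₃ε₁ ((28) and (103) DERIVED from (14)'s two readings); (ii) the same for every `𝔄` with the bounds (103); (iii) the solution
is an analytic function of `𝔄`.  The printed Sect. E argument is the kernel proof (`B11Prop6Scheme`, `B11Eq174Chart`); the in-edge letters [5] Thms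
3.12/3.13 and the slot Prop. 4 are the datum's displayed fields (NOT proved here). [cite: Balaban1985Variational, Prop. 6 pp.295–296] -/
theorem prop6Printed_concrete (hB₀ : 0 < B₀) (hC₄ : 0 < C₄) (ha₃ : 0 < a₃) (hB₃ : 0 < B₃) (hα : 0 < α) {C₁ : ℝ} (hC₁ : 0 < C₁)
    (D : ∀ i, SectEDatum d (Pdf i) 𝔸 L (ηf i) (βf i) B₀ C₄ a₃ B₃ α) (R : ∀ i, Rest (D i)) :
    B11.Prop6Printed B₀ B₃ C₁ (fun i => (D i).toLGData (R i) C₁) := by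
  refine ⟨min (min (a₃ / 4) (1 / (16 * B₀ * C₄))) (2 * B₀ * α), lt_min (lt_min (by positivity) (by positivity)) (by positivity), ?_⟩
  intro i ε₁ ε₄ hε₁ hε₄a h1 V c h14
  obtain ⟨hε₄a', hε₄α⟩ := le_min_iff.1 hε₄a
  obtain ⟨h2, h3⟩ := (le_a4_iff (mul_pos hB₀ hC₄)).1 hε₄a'
  -- (14) at radius C₁B₃ε₁ ≤ ε₄/(2B₀) ≤ α: the background is admissible
  have hrad : C₁ * B₃ * ε₁ ≤ α := by
    by_contra hlt
    have : 2 * B₀ * α < 2 * B₀ * (C₁ * B₃ * ε₁) := mul_lt_mul_of_pos_left (lt_of_not_ge hlt) (by positivity)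
    nlinarith
  have hc : (D i).Adm c := (D i).adm_of (R i) C₁ h14 hrad
  have hH : ‖(D i).H₁B V c‖ < 2 * ((d : ℝ) * L) * B₀ * C₁ * ε₁ := (D i).norm_H₁B_lt (R i) C₁ hB₀ hc h14
  refine ⟨?_, ?_, ?_⟩
  · -- (i) the datum H₁B
    obtain ⟨A₁, hA, hsol, hA3, huniq⟩ := exists_solution_carrier (D i) (R i) hB₀ hC₄ hC₁ hB₃ hε₁ h1 h2 h3 hc h14 hH
    exact ⟨A₁, hA, hsol, hA3, huniq⟩
  · -- (ii) an arbitrary 𝔄 «satisfying the same bounds as H₁B»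
    intro 𝔄 h𝔄
    obtain ⟨A₁, hA, hsol, -, huniq⟩ := exists_solution_carrier (D i) (R i) hB₀ hC₄ hC₁ hB₃ hε₁ h1 h2 h3 hc h14 h𝔄
    exact ⟨A₁, hA, hsol, huniq⟩
  · -- (iii) «the solution is an analytic function of 𝔄»
    intro Vs hVs 𝔄f h𝔄d h𝔄b
    exact solution_analytic_concrete ((D i).bg c) ((D i).norm_G c hc) ((D i).prop4 c hc) hB₀ hC₄ hC₁ hB₃ hε₁ (D i).dL_le h1 h2 h3
      ((D i).bg_unitary c) ((D i).sat14_cur_of (R i) C₁ h14) hVs h𝔄d h𝔄b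

omit [FiniteDimensional ℂ 𝔸] [NormedStarGroup 𝔸] [StarModule ℂ 𝔸] in
/-- **Dictionary (no new content): on this family the typed Proposition 4 `B11.Prop4Printed C₁ B₃ famLG` (pp. 292–293) holds with the constants
(a₃/2, C₄) and the threshold `ε₁ ≤ α/(C₁B₃)` (which makes the backgrounds of (14) admissible) BY the datum field `prop4`** — Proposition 4 is the leaf's own conjunct p4, an INPUT of this file (at letters: `B11Eq98CurrentSlot.prop4Hyp_W80`,
`B11Ineq73KernelLettersUniform.exists_quadAnalytic_W80_uniform`; termwise assembly `B11Prop4Assembly`).  Radius a₃/2 because `Prop4Hyp` is stated on the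
open ball ‖·‖ < a₃ while (98) is typed with «≤ a₃». [cite: Balaban1985Variational, Prop. 4 (97)–(98) pp.292–293] -/
theorem prop4Printed_concrete (hC₄ : 0 < C₄) (ha₃ : 0 < a₃) (hB₃ : 0 < B₃) (hα : 0 < α) {C₁ : ℝ} (hC₁ : 0 < C₁)
    (D : ∀ i, SectEDatum d (Pdf i) 𝔸 L (ηf i) (βf i) B₀ C₄ a₃ B₃ α) (R : ∀ i, Rest (D i)) :
    B11.Prop4Printed C₁ B₃ (fun i => (D i).toLGData (R i) C₁) := by
  refine ⟨a₃ / 2, C₄, α / (C₁ * B₃), by positivity, hC₄, by positivity, ?_⟩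
  intro i ε₁ hε₁ hε₁c V c h14
  -- (14) at radius C₁B₃ε₁ ≤ α: the background is admissible
  have hrad : C₁ * B₃ * ε₁ ≤ α := by
    have h := mul_le_mul_of_nonneg_left hε₁c (le_of_lt (mul_pos hC₁ hB₃))
    rwa [mul_div_cancel₀ _ (ne_of_gt (mul_pos hC₁ hB₃))] at h
  have hc : (D i).Adm c := (D i).adm_of (R i) C₁ h14 hrad
  dsimp only [SectEDatum.toLGData]
  refine ⟨fun ε₃ hε₃ hε₃a => ⟨?_, fun A hA => ?_⟩, fun A hA => ?_⟩
  · exact ((D i).prop4 c hc).differentiableOn.mono fun Y (hY : ‖Y‖ < ε₃) => show ‖Y‖ < a₃ by linarith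
  · have hq := ((D i).prop4 c hc).quad ((D i).toSp c A) (by linarith)
    have h0 : 0 ≤ ‖(D i).toSp c A‖ := norm_nonneg _
    have hsq : ‖(D i).toSp c A‖ ^ 2 < ε₃ ^ 2 := by nlinarith
    exact hq.trans_lt (mul_lt_mul_of_pos_left hsq hC₄)
  · exact ((D i).prop4 c hc).quad ((D i).toSp c A) (by linarith)

end Family

end Literature.MathematicalPhysics.QuantumFieldTheory.Balaban1983to89.B11Prop6Concrete

end
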